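import Literature.AlgebraicGeometry.Resolution.BlowupsFlatBaseChange
import Literature.AlgebraicGeometry.Resolution.AlterationsNormalFormBlowupFormal
import Literature.AlgebraicGeometry.Resolution.BlowupChartMembership
import HarnessLib

/-!
# [OURS · L1 W4.5(b) · EL♮(3)] HSUB(ReachTC⁺) — A BLOW-UP WHOSE CENTRE IS PRINCIPAL (NON-ZERO-DIVISOR) AT `x` DOES NOT CHANGE THE
# LOCAL RINGS OVER `x` (registered stub `stub_elnat_tcPlusPointResolution`; brick K7c, clause (v) of `TCPlus.Member` after a
# regular in-carrier step)

Crux `EquisingularLiftNat` = stmt-ResolutionOfSingularities-20038 (child EL♮(3) = stmt-ResolutionOfSingularities-20148), route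
EquisingularLift, line `sections`. Helper file `--supports stmt-ResolutionOfSingularities-20148 --as helper` by res-L1-w45b-stub-1
(HSUB(ReachTC⁺) assembly). HONEST FRAMING: OURS (cell res-hironaka, slot W4.5(b)); a folklore fact of blow-up theory
(Görtz–Wedhorn 13.91 + «blowing up an effective Cartier divisor is an isomorphism»), NOT a statement of any manuscript;
AI-written, weaker than expert review. No `sorry`; standard axioms.

WHY. After a REGULAR in-carrier step the surface `D = V(𝓢) ∩ V(K)` is blown up along the section `Γ = V(ker s) ∩ D`, which near
the stepped point `p` (where `D` is a regular surface) is an effective Cartier divisor of `D`: so the strict transform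
`St(D) → D` is a LOCAL ISOMORPHISM over `p`, and the quotient stalks of `St(𝓢) ⊔ St(K)` over `p` are `≅ 𝒪_{D,p}` — regular of
dimension `2` again (clause (v) of `TCPlus.Member`, res-L1-w45b-stub-1 …NatSubchainSupplierInvDefs v3). This file is the general
local statement:

* **`isIso_stalkMap_of_isBlowup_of_stalkIdeal_eq_span_singleton`** — `π : X' → X` a blow-up along `J`, `J_x = (g)` with `g` a
  non-zero-divisor of `𝒪_{X,x}`: then `π^♯ : 𝒪_{X,x} → 𝒪_{X',x'}` is an isomorphism for EVERY `x'` over `x` (the one theorem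
  of this file).

PROOF. Base change along the flat pro-open immersion `Spec 𝒪_{X,x} → X` (Literature `IsBlowup.pullback_snd_of_flat`): the
pulled-back blow-up is the blow-up of `Spec 𝒪_{X,x}` along `(g)~` (`comap_fromSpecStalk_eq_ofIdealTop`), an effective Cartier
divisor (`isEffectiveCartier_of_ideal_top_eq_span`), hence an isomorphism (`IsBlowup.isIso`); the projection
`X' ×_X Spec 𝒪_{X,x} → X'` and `Spec 𝒪_{X,x} → X` induce isomorphisms of local rings (`isIso_stalkMap_pullback_fst_fromSpecStalk`,
`isIso_stalkMap_of_flat_of_isPreimmersion`), and every `x'` over `x` is hit (`mem_range_pullback_fst_fromSpecStalk_of_eq`).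

References: [cite: GortzWedhorn2020, Prop. 13.91 (2) and (13.19) p. 413]; [cite: StacksProject, Tag 0805].
-/

set_option linter.dupNamespace false -- mandated namespace `Summit.<Summit>.<Problem>` of this single-conjunct summit

noncomputable section

open CategoryTheory CategoryTheory.Limits AlgebraicGeometry TopologicalSpace
open Literature.AlgebraicGeometry.Resolution
open AlgebraicGeometry.Scheme.IdealSheafData

namespace Summit.ResolutionOfSingularities.ResolutionOfSingularities.Cruxes.EquisingularLiftNat.Sections

universe u

/-- **A blow-up whose centre is principal, generated by a non-zero-divisor, at `x` induces isomorphisms of local rings over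
`x`.** `π : X' → X` a blow-up along `J`, `x ∈ X` with `J_x = (g)`, `g ∈ 𝒪_{X,x}` a non-zero-divisor; then for every `x' ∈ X'`
with `π x' = x` the stalk map `π^♯_{x'} : 𝒪_{X,x} → 𝒪_{X',x'}` is an isomorphism (the blow-up of `Spec 𝒪_{X,x}` along the
effective Cartier divisor `(g)` is an isomorphism, and blow-ups commute with the flat base change `Spec 𝒪_{X,x} → X`).
[cite: GortzWedhorn2020, Prop. 13.91 (2)] [cite: StacksProject, Tag 0805] [OURS · L1 W4.5b] helper toward
`stub_elnat_tcPlusPointResolution`; NOT a statement of the manuscript. -/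
theorem isIso_stalkMap_of_isBlowup_of_stalkIdeal_eq_span_singleton {X' X : Scheme.{u}} {π : X' ⟶ X} {J : X.IdealSheafData}
    (hπ : IsBlowup π J) {x : X} {g : X.presheaf.stalk x} (hg : g ∈ nonZeroDivisors (X.presheaf.stalk x))
    (hJx : stalkIdeal J x = Ideal.span {g}) {x' : X'} (hx' : π x' = x) : IsIso (π.stalkMap x') := by
  haveI := flat_fromSpecStalk X x
  -- the base-changed blow-up is the blow-up of `Spec 𝒪_{X,x}` along the effective Cartier divisor `(g)`: an isomorphism
  have hb : IsBlowup (pullback.snd π (X.fromSpecStalk x)) (J.comap (X.fromSpecStalk x)) :=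
    hπ.pullback_snd_of_flat (X.fromSpecStalk x)
  have hcart : IsEffectiveCartier (J.comap (X.fromSpecStalk x)) := by
    rw [comap_fromSpecStalk_eq_ofIdealTop x J]
    refine isEffectiveCartier_of_ideal_top_eq_span _
      (g := (Scheme.ΓSpecIso (X.presheaf.stalk x)).inv.hom g) ?_ ?_
    · -- a non-zero-divisor stays one under the ring isomorphism `𝒪_{X,x} ≅ Γ(Spec 𝒪_{X,x}, ⊤)`
      let e : X.presheaf.stalk x ≃+* Γ(Spec (X.presheaf.stalk x), ⊤) :=
        (Scheme.ΓSpecIso (X.presheaf.stalk x)).symm.commRingCatIsoToRingEquiv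
      change e g ∈ nonZeroDivisors _
      refine mem_nonZeroDivisors_iff_right.mpr fun a ha => ?_
      have h1 : e.symm a * g = 0 := by
        apply e.injective
        rw [map_mul, e.apply_symm_apply, map_zero, ha]
      have h2 : e.symm a = 0 := (mem_nonZeroDivisors_iff_right.mp hg) _ h1
      simpa using congrArg e h2
    · rw [ideal_ofIdealTop_top, hJx, Ideal.map_span, Set.image_singleton]
  haveI hsndIso : IsIso (pullback.snd π (X.fromSpecStalk x)) := hb.isIso hcart
  -- every point over `x` is hit by the projection `X' ×_X Spec 𝒪_{X,x} → X'`
  obtain ⟨s, rfl⟩ := mem_range_pullback_fst_fromSpecStalk_of_eq π x hx'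
  haveI h1 : IsIso ((pullback.fst π (X.fromSpecStalk x)).stalkMap s) :=
    isIso_stalkMap_pullback_fst_fromSpecStalk π x s
  haveI h2 : IsIso ((X.fromSpecStalk x).stalkMap ((pullback.snd π (X.fromSpecStalk x)) s)) :=
    isIso_stalkMap_of_flat_of_isPreimmersion (X.fromSpecStalk x) _
  haveI h3 : IsIso ((pullback.snd π (X.fromSpecStalk x)).stalkMap s) :=
    isIso_stalkMap_of_flat_of_isPreimmersion (pullback.snd π (X.fromSpecStalk x)) s
  have hcomp : IsIso ((pullback.fst π (X.fromSpecStalk x) ≫ π).stalkMap s) := by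
    rw [pullback.condition, Scheme.Hom.stalkMap_comp]
    exact @IsIso.comp_isIso _ _ _ _ _ _ _ h2 h3
  rw [Scheme.Hom.stalkMap_comp] at hcomp
  exact @IsIso.of_isIso_comp_right _ _ _ _ _ (π.stalkMap ((pullback.fst π (X.fromSpecStalk x)) s))
    ((pullback.fst π (X.fromSpecStalk x)).stalkMap s) h1 hcomp

end Summit.ResolutionOfSingularities.ResolutionOfSingularities.Cruxes.EquisingularLiftNat.Sections

end
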